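import Summits.ResolutionOfSingularities.ResolutionOfSingularities.Theorems.HomologicalConductorNoZenoSandwichBaseChange
import Summits.ResolutionOfSingularities.ResolutionOfSingularities.Theorems.HomologicalConductorNoZenoUpstairsCount
import Summits.ResolutionOfSingularities.ResolutionOfSingularities.Theorems.HomologicalConductorNoZenoPrincipalBaseChange
import Summits.ResolutionOfSingularities.ResolutionOfSingularities.Theorems.HomologicalConductorNoZenoHfibreSplitting
import Summits.ResolutionOfSingularities.ResolutionOfSingularities.Theorems.HomologicalConductorNoZenoHalgNode
import Summits.ResolutionOfSingularities.ResolutionOfSingularities.Theorems.HomologicalConductorNoZenoCentreBaseChange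
import Summits.ResolutionOfSingularities.ResolutionOfSingularities.Theorems.HomologicalConductorNoZenoHtwoDischarge
import Summits.ResolutionOfSingularities.ResolutionOfSingularities.Theorems.HomologicalConductorNoZenoNodeBlowupResolution
import Summits.ResolutionOfSingularities.ResolutionOfSingularities.Theorems.HomologicalConductorNoZenoExcCurveLift
import Summits.ResolutionOfSingularities.ResolutionOfSingularities.Theorems.HomologicalConductorNoZenoSandwichChartData
import Summits.ResolutionOfSingularities.ResolutionOfSingularities.Theorems.HomologicalConductorNoZenoCurveIntersectionFinite
import Summits.ResolutionOfSingularities.ResolutionOfSingularities.Theorems.HomologicalConductorNoZenoSplitDataThread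
import HarnessLib

/-!
# Crux `NoZenoR` (stmt-ResolutionOfSingularities-19943), β layer, slot 5 — seam0 ASSEMBLED: `exists_sandwichData`
# (the eight upstairs binders of res-L0-w44-lead-1's `l1wCore_of_sandwichData`, for ONE splitting polynomial `f`)

Route `ResolutionOfSingularities/HomologicalConductor`, crux chain W4.4.  OURS (cell res-hironaka; object «CONTRACT for the last brick»
of res-L0-w44-lead-1 2026-08-27T22:11:23Z, hand res-D-pv-039; consumer: the slot-5 closer `l1wCore_of_sandwichData` (p577684) —
its eight binders `hπf · hNf · hw1f · hNcfin · hNccl · hρf · hsplitf · hprinf` VERBATIM).  Assembly BY NAME of: the (F-out) choice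
`exists_splitting_threadPoly` + transport `splits_clause_of_comp` (res-D-pv-039 p576859), (U2w) `upstairs_count_le` (p575757), (BC-I)
`isPrincipal_map_toStalk_of_sq` (p574645), the field step `hfibre_of_splitting` (p577472) with `halg` from
`finite_residueField_of_specializes` (p577790), res-D-pv-045's centre / (BC-ρ) / `hsplit_upstairs_pullback` (p574326), res-L0-w44-stub-4's
`htwo_discharge_of_inter` (p576385), res-L1-type-o5's node package `NodeBlowup.isResolution_comp / isProper / isIntegral / hnode`
(p568319/p570881), res-L0-w44-stub-3's lifts `exists_mem_excCurvePoints_apply_eq_and_bijective` (p569212) and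
`excCurvePoints_finite_of_isResolution` (p570053), res-L0-w44-stub-2's germ descent `isResolution_pullback_germ` and the one-root germ API.
AI-written, weaker than expert review; nothing here is a statement of the manuscript under review (Hironaka 2017); no Theses file is
imported.  Def-free, `--supports 19943 --as helper`.  CONDITIONAL on the route's Literature named facts Lipman 1969 (13.1) d), (16.1)(ii),
(16.5) (binders `h131d h161 h165`, all in `Sig.FactsW3`).

* `preimage_image_coe_eq` — bookkeeping: the upstairs `L1Core` ideal generators `{d : D_f | (d : K_f) ∈ K → K_f '' C}` are exactly the
  images of `{d : D | (d : K) ∈ C}` (`C ⊆ D`);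
* **`exists_sandwichData`** — for `D = T_P` (`T` essentially of finite type, normal, `Frac T = K`; `dim D = 2`, rational), a resolution
  `π` with finitely many exceptional curves and `splitExcCount π ≤ N`, the node blow-up `ρ` of `sepNodes π` with the sandwich clause
  `hprin` for `I = span {d | (d:K) ∈ C}`: THERE IS a thread polynomial `f` (monic, `f̄` irreducible separable, `f_K` irreducible,
  `P_f` prime) such that over the one-root germ `D_f` the base-changed data `π_f, σ, ρ_f = pullback.snd ρ σ` satisfy the eight binders.

References: J. Lipman, Publ. Math. IHÉS 36 (1969), §16 (16.1) p. 231, (16.5) p. 235, §24 p. 258 [`Lipman1969`].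
-/

noncomputable section

-- single-problem summit: the doubled namespace component `ResolutionOfSingularities` is forced
set_option linter.dupNamespace false

namespace Summit.ResolutionOfSingularities.ResolutionOfSingularities.Theorems.NoZeno.ExcCount

open CategoryTheory CategoryTheory.Limits AlgebraicGeometry TopologicalSpace IsLocalRing Polynomial
open Literature.AlgebraicGeometry.Resolution
open Summit.ResolutionOfSingularities.ResolutionOfSingularities.Theorems.NoZeno.SandwichCluster
open Parasite (locPrime isLocalRing_locPrime)
open Summit.ResolutionOfSingularities.ResolutionOfSingularities.Theorems.NoZeno.SplittingBase
open scoped TensorProduct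

variable {k K : Type} [Field k] [Field K] [Algebra k K]

/-- **Bookkeeping for the upstairs `L1Core` ideal**: for `C ⊆ D ⊆ K` and the one-root germ `D_f ⊆ K_f`, the set
`{d : D_f | (d : K_f) ∈ (K → K_f) '' C}` is the image of `{d : D | (d : K) ∈ C}` under `D → D_f`. [this work] -/
theorem preimage_image_coe_eq (D : Subalgebra k K) [IsLocalRing ↥D] (f : (↥D)[X])
    [Fact (Irreducible (f.map (algebraMap ↥D K)))] (hPf : (splitPrime D f).IsPrime)
    (C : Set K) (hCD : C ⊆ (D : Set K)) :
    {d : ↥(locPrime (splitModel D f) (splitPrime D f) hPf) |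
        (d : AdjoinRoot (f.map (algebraMap ↥D K))) ∈ algebraMap K (AdjoinRoot (f.map (algebraMap ↥D K))) '' C} =
      algebraMap ↥D ↥(locPrime (splitModel D f) (splitPrime D f) hPf) '' {d : ↥D | (d : K) ∈ C} := by
  ext d
  constructor
  · rintro ⟨c, hc, hcd⟩
    refine ⟨⟨c, hCD hc⟩, hc, Subtype.ext ?_⟩
    rw [coe_algebraMap_germ]
    exact hcd
  · rintro ⟨d₀, hd₀, rfl⟩
    exact ⟨(d₀ : K), hd₀, (coe_algebraMap_germ D f hPf d₀).symm⟩

set_option maxHeartbeats 800000 in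
/-- **seam0 ASSEMBLED — `exists_sandwichData`.**  In the notation of `Sig.L1Core` (`D = locPrimeSubalgebra T P hP = T_P`, `C`,
the habitat `π : X → Spec T_P` — a resolution with finitely many integral exceptional curves and `splitExcCount π ≤ N` — and the node
blow-up `ρ : X¹ → X` of `sepNodes π` with `I·𝒪_{X¹}` principal at local-structure points, `I = span {d | (d : K) ∈ C}`): there is a
thread polynomial `f` over `D` (monic, `f̄` irreducible separable, `f_K` irreducible, `P_f` prime) such that, with `D_f` the one-root
germ, `g = Spec (D → D_f)`, `π_f = pullback.snd π g`, `σ = pullback.fst π g`, `ρ_f = pullback.snd ρ σ`: `π_f` is a resolution;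
`splitExcCount π_f ≤ N`; every split weight of `π_f` is `1`; `σ⁻¹(sepNodes π)` is a finite set of closed points; `ρ_f` is the blow-up
of its vanishing ideal; two distinct exceptional curves of `π_f` pass through each of its points; and `(I·D_f)·𝒪_{X¹_f}` (in the
`L1Core` spelling `span {d : D_f | (d : K_f) ∈ K → K_f '' C}`) is principal at every local-structure point — the eight binders of
res-L0-w44-lead-1's `l1wCore_of_sandwichData`, verbatim. [this work; conditional on `Lipman1969_13_1_d_rat`, `_16_1_ii`, `_16_5`] -/
theorem exists_sandwichData
    (h131d : Lipman1969_13_1_d_rat.{0}) (h161 : Lipman1969_16_1_ii.{0}) (h165 : Lipman1969_16_5.{0})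
    (T : Subalgebra k K) (P : Ideal ↥T) (hP : P.IsPrime)
    [Algebra.EssFiniteType k ↥T] [IsIntegrallyClosed ↥T] [IsFractionRing ↥T K]
    (hdim : ringKrullDim ↥(locPrime T P hP) = 2) (hrat : HasRationalSingularity ↥(locPrime T P hP))
    (N : ℕ) (C : Set K) (hCT : C ⊆ (T : Set K))
    {X : Scheme.{0}} (π : X ⟶ Spec (.of ↥(locPrime T P hP))) (hπ : IsResolution π)
    (hfin : (excCurvePoints π).Finite) (hle : splitExcCount π ≤ N)
    {X1 : Scheme.{0}} (ρ : X1 ⟶ X)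
    (hρ : IsBlowup ρ (Scheme.IdealSheafData.vanishingIdeal ⟨closure (sepNodes π), isClosed_closure⟩))
    (hprin : ∀ x₁ : X1, IsLocalHom (toStalk (ρ ≫ π) x₁) →
      ((Ideal.span {d : ↥(locPrime T P hP) | (d : K) ∈ C}).map (toStalk (ρ ≫ π) x₁)).IsPrincipal) :
    ∃ (f : (↥(locPrimeSubalgebra T P hP))[X]) (_ : f.Monic)
      (_ : Irreducible (f.map (residue ↥(locPrimeSubalgebra T P hP))))
      (_ : (f.map (residue ↥(locPrimeSubalgebra T P hP))).Separable)
      (_ : Fact (Irreducible (f.map (algebraMap ↥(locPrimeSubalgebra T P hP) K))))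
      (hPf : (splitPrime (locPrimeSubalgebra T P hP) f).IsPrime)
      (_ : IsResolution (pullback.snd π (Spec.map (CommRingCat.ofHom (algebraMap ↥(locPrimeSubalgebra T P hP)
        ↥(locPrime (splitModel (locPrimeSubalgebra T P hP) f) (splitPrime (locPrimeSubalgebra T P hP) f) hPf))))))
      (_ : splitExcCount (pullback.snd π (Spec.map (CommRingCat.ofHom (algebraMap ↥(locPrimeSubalgebra T P hP)
        ↥(locPrime (splitModel (locPrimeSubalgebra T P hP) f) (splitPrime (locPrimeSubalgebra T P hP) f) hPf))))) ≤ N)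
      (_ : ∀ η ∈ excCurvePoints (pullback.snd π (Spec.map (CommRingCat.ofHom (algebraMap ↥(locPrimeSubalgebra T P hP)
        ↥(locPrime (splitModel (locPrimeSubalgebra T P hP) f) (splitPrime (locPrimeSubalgebra T P hP) f) hPf))))),
        splitWeight (pullback.snd π (Spec.map (CommRingCat.ofHom (algebraMap ↥(locPrimeSubalgebra T P hP)
          ↥(locPrime (splitModel (locPrimeSubalgebra T P hP) f) (splitPrime (locPrimeSubalgebra T P hP) f) hPf))))) η = 1)
      (hNcfin : ((pullback.fst π (Spec.map (CommRingCat.ofHom (algebraMap ↥(locPrimeSubalgebra T P hP)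
        ↥(locPrime (splitModel (locPrimeSubalgebra T P hP) f) (splitPrime (locPrimeSubalgebra T P hP) f) hPf))))).base ⁻¹'
          sepNodes π).Finite)
      (hNccl : ∀ z₁ ∈ (pullback.fst π (Spec.map (CommRingCat.ofHom (algebraMap ↥(locPrimeSubalgebra T P hP)
        ↥(locPrime (splitModel (locPrimeSubalgebra T P hP) f) (splitPrime (locPrimeSubalgebra T P hP) f) hPf))))).base ⁻¹'
          sepNodes π, IsClosed ({z₁} : Set _))
      (_ : IsBlowup (pullback.snd ρ (pullback.fst π (Spec.map (CommRingCat.ofHom (algebraMap ↥(locPrimeSubalgebra T P hP)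
        ↥(locPrime (splitModel (locPrimeSubalgebra T P hP) f) (splitPrime (locPrimeSubalgebra T P hP) f) hPf))))))
        (Scheme.IdealSheafData.vanishingIdeal ⟨(pullback.fst π (Spec.map (CommRingCat.ofHom (algebraMap
          ↥(locPrimeSubalgebra T P hP) ↥(locPrime (splitModel (locPrimeSubalgebra T P hP) f)
            (splitPrime (locPrimeSubalgebra T P hP) f) hPf))))).base ⁻¹' sepNodes π,
          FiniteCentreBlowup.isClosed_of_finite_of_isClosed_singleton hNcfin hNccl⟩))
      (_ : ∀ z₁ ∈ (pullback.fst π (Spec.map (CommRingCat.ofHom (algebraMap ↥(locPrimeSubalgebra T P hP)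
        ↥(locPrime (splitModel (locPrimeSubalgebra T P hP) f) (splitPrime (locPrimeSubalgebra T P hP) f) hPf))))).base ⁻¹'
          sepNodes π, ∃ a b,
          a ∈ excCurvePoints (pullback.snd π (Spec.map (CommRingCat.ofHom (algebraMap ↥(locPrimeSubalgebra T P hP)
            ↥(locPrime (splitModel (locPrimeSubalgebra T P hP) f) (splitPrime (locPrimeSubalgebra T P hP) f) hPf))))) ∧
          b ∈ excCurvePoints (pullback.snd π (Spec.map (CommRingCat.ofHom (algebraMap ↥(locPrimeSubalgebra T P hP)
            ↥(locPrime (splitModel (locPrimeSubalgebra T P hP) f) (splitPrime (locPrimeSubalgebra T P hP) f) hPf))))) ∧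
          a ≠ b ∧ a ⤳ z₁ ∧ b ⤳ z₁),
      ∀ x₁ : ↑(pullback ρ (pullback.fst π (Spec.map (CommRingCat.ofHom (algebraMap ↥(locPrimeSubalgebra T P hP)
        ↥(locPrime (splitModel (locPrimeSubalgebra T P hP) f) (splitPrime (locPrimeSubalgebra T P hP) f) hPf)))))),
        IsLocalHom (toStalk (pullback.snd ρ (pullback.fst π (Spec.map (CommRingCat.ofHom (algebraMap
            ↥(locPrimeSubalgebra T P hP) ↥(locPrime (splitModel (locPrimeSubalgebra T P hP) f)
              (splitPrime (locPrimeSubalgebra T P hP) f) hPf))))) ≫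
          pullback.snd π (Spec.map (CommRingCat.ofHom (algebraMap ↥(locPrimeSubalgebra T P hP)
            ↥(locPrime (splitModel (locPrimeSubalgebra T P hP) f) (splitPrime (locPrimeSubalgebra T P hP) f) hPf))))) x₁) →
        ((Ideal.span {d : ↥(locPrime (splitModel (locPrimeSubalgebra T P hP) f) (splitPrime (locPrimeSubalgebra T P hP) f) hPf) |
            (d : AdjoinRoot (f.map (algebraMap ↥(locPrimeSubalgebra T P hP) K))) ∈
              algebraMap K (AdjoinRoot (f.map (algebraMap ↥(locPrimeSubalgebra T P hP) K))) '' C}).map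
          (toStalk (pullback.snd ρ (pullback.fst π (Spec.map (CommRingCat.ofHom (algebraMap
              ↥(locPrimeSubalgebra T P hP) ↥(locPrime (splitModel (locPrimeSubalgebra T P hP) f)
                (splitPrime (locPrimeSubalgebra T P hP) f) hPf))))) ≫
            pullback.snd π (Spec.map (CommRingCat.ofHom (algebraMap ↥(locPrimeSubalgebra T P hP)
              ↥(locPrime (splitModel (locPrimeSubalgebra T P hP) f) (splitPrime (locPrimeSubalgebra T P hP) f) hPf))))) x₁)).IsPrincipal := by
  classical
  -- ### the germ `D = T_P` in both spellings
  haveI : IsNoetherianRing ↥T := Algebra.EssFiniteType.isNoetherianRing k ↥T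
  haveI := hP
  haveI : IsLocalRing ↥(locPrime T P hP) := isLocalRing_locPrime T P hP
  haveI : IsNoetherianRing ↥(locPrime T P hP) :=
    (inferInstance : IsNoetherianRing ↥(locPrimeSubalgebra T P hP))
  haveI : IsIntegrallyClosed ↥(locPrime T P hP) := Thread.isIntegrallyClosed_locPrime T P hP
  have hdimD : ringKrullDim ↥(locPrimeSubalgebra T P hP) = 2 := hdim
  have hratD : HasRationalSingularity ↥(locPrimeSubalgebra T P hP) := hrat
  haveI : IsProper π := hπ.isProper
  haveI : IsIntegral X := hπ.isIntegral_source
  -- ### the node blow-up `ρ ≫ π`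
  have hψ : IsResolution (ρ ≫ π) := NodeBlowup.isResolution_comp π ρ hfin hπ hρ
  haveI : IsProper ρ := NodeBlowup.isProper π ρ hρ
  haveI : IsIntegral X1 := NodeBlowup.isIntegral π ρ hfin hρ
  haveI : IsProper (ρ ≫ π) := hψ.isProper
  haveI : IsLocallyNoetherian X1 := LocallyOfFiniteType.isLocallyNoetherian (ρ ≫ π)
  have hfin1 : (excCurvePoints (ρ ≫ π)).Finite := excCurvePoints_finite_of_isResolution hdim hψ
  -- the same morphisms, read over `Spec D` in the `locPrimeSubalgebra` spelling (same carrier, `let` = definitional)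
  let πD : X ⟶ Spec (.of ↥(locPrimeSubalgebra T P hP)) := π
  let ψD : X1 ⟶ Spec (.of ↥(locPrimeSubalgebra T P hP)) := ρ ≫ πD
  haveI : LocallyOfFiniteType πD := (inferInstance : LocallyOfFiniteType π)
  haveI : IsProper πD := (inferInstance : IsProper π)
  haveI : LocallyOfFiniteType ψD := (inferInstance : LocallyOfFiniteType (ρ ≫ π))
  haveI : IsProper ψD := (inferInstance : IsProper (ρ ≫ π))
  -- ### the finite set of points to split: all exceptional curves of `ρ ≫ π` and all their pairwise intersections
  have hS1fin : (excCurvePoints (ρ ≫ π) ∪ {y : X1 | ∃ a ∈ excCurvePoints (ρ ≫ π), ∃ b ∈ excCurvePoints (ρ ≫ π),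
      a ≠ b ∧ a ⤳ y ∧ b ⤳ y}).Finite := by
    refine hfin1.union ?_
    refine ((hfin1.biUnion fun a ha => hfin1.biUnion fun b hb =>
      (show ({y : X1 | a ≠ b ∧ a ⤳ y ∧ b ⤳ y}).Finite from ?_))).subset ?_
    · by_cases hab : a = b
      · have : {y : X1 | a ≠ b ∧ a ⤳ y ∧ b ⤳ y} = ∅ := by
          ext y; simp [hab]
        rw [this]; exact Set.finite_empty
      · refine (finite_closure_inter_closure_of_mem_excCurvePoints (ρ ≫ π) ha hb hab).subset ?_
        rintro y ⟨-, hay, hby⟩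
        exact ⟨specializes_iff_mem_closure.mp hay, specializes_iff_mem_closure.mp hby⟩
    · rintro y ⟨a, ha, b, hb, hab, hay, hby⟩
      simp only [Set.mem_iUnion, Set.mem_setOf_eq]
      exact ⟨a, ha, b, hb, hab, hay, hby⟩
  have hS1π : ∀ y ∈ excCurvePoints (ρ ≫ π) ∪ {y : X1 | ∃ a ∈ excCurvePoints (ρ ≫ π), ∃ b ∈ excCurvePoints (ρ ≫ π),
      a ≠ b ∧ a ⤳ y ∧ b ⤳ y}, ψD.base y = closedPoint ↥(locPrimeSubalgebra T P hP) := by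
    rintro y (hy | ⟨a, ha, b, -, -, hay, -⟩)
    · exact hy.1
    · exact base_eq_closedPoint_of_specializes (ρ ≫ π) ha.1 hay
  -- ### (F-out) the thread polynomial
  obtain ⟨f, hf, hirr, hsep, hfact, hPf, hcl⟩ := exists_splitting_threadPoly (locPrimeSubalgebra T P hP) ψD
    _ hS1fin hS1π
  haveI := hfact
  -- ### the one-root germ `D_f` and `g : Spec D_f → Spec D`
  haveI := isLocalHom_germ (locPrimeSubalgebra T P hP) f hf hirr hPf
  haveI := isNoetherianRing_germ (locPrimeSubalgebra T P hP) f hf hirr hPf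
  haveI := finite_germ (locPrimeSubalgebra T P hP) f hf hirr hPf
  haveI := flat_germ (locPrimeSubalgebra T P hP) f hf hirr hPf
  haveI := etale_germ (locPrimeSubalgebra T P hP) f hf hirr hsep hPf
  haveI := isIntegrallyClosed_germ (locPrimeSubalgebra T P hP) f hf hirr hsep hPf
  have hdimf : ringKrullDim ↥(locPrime (splitModel (locPrimeSubalgebra T P hP) f) (splitPrime (locPrimeSubalgebra T P hP) f) hPf) = 2 :=
    (ringKrullDim_germ (locPrimeSubalgebra T P hP) f hf hirr hsep hPf).trans hdimD
  have hratf : HasRationalSingularity ↥(locPrime (splitModel (locPrimeSubalgebra T P hP) f)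
      (splitPrime (locPrimeSubalgebra T P hP) f) hPf) :=
    hasRationalSingularity_germ h165 (locPrimeSubalgebra T P hP) f hf hirr hsep hPf hdimD hratD
  have hg := preimage_closedPoint_germ (locPrimeSubalgebra T P hP) f hf hirr hPf
  have hyg := specMap_closedPoint ↥(locPrimeSubalgebra T P hP)
    ↥(locPrime (splitModel (locPrimeSubalgebra T P hP) f) (splitPrime (locPrimeSubalgebra T P hP) f) hPf)
  have hgfin : IsFinite (Spec.map (CommRingCat.ofHom (algebraMap ↥(locPrimeSubalgebra T P hP)
      ↥(locPrime (splitModel (locPrimeSubalgebra T P hP) f) (splitPrime (locPrimeSubalgebra T P hP) f) hPf)))) :=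
    isFinite_specMap_germ (locPrimeSubalgebra T P hP) f hf hirr hPf
  have hgflat : Flat (Spec.map (CommRingCat.ofHom (algebraMap ↥(locPrimeSubalgebra T P hP)
      ↥(locPrime (splitModel (locPrimeSubalgebra T P hP) f) (splitPrime (locPrimeSubalgebra T P hP) f) hPf)))) := by
    rw [HasRingHomProperty.Spec_iff (P := @Flat), CommRingCat.hom_ofHom, RingHom.flat_algebraMap_iff]
    infer_instance
  have hgunr : FormallyUnramified (Spec.map (CommRingCat.ofHom (algebraMap ↥(locPrimeSubalgebra T P hP)
      ↥(locPrime (splitModel (locPrimeSubalgebra T P hP) f) (splitPrime (locPrimeSubalgebra T P hP) f) hPf)))) := by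
    rw [HasRingHomProperty.Spec_iff (P := @FormallyUnramified), CommRingCat.hom_ofHom,
      RingHom.formallyUnramified_algebraMap]
    infer_instance
  -- the same classes with the codomain read as `Spec T_P` (the spelling of the habitat `π`)
  haveI : IsFinite (Y := Spec (.of ↥(locPrime T P hP))) (Spec.map (CommRingCat.ofHom (algebraMap ↥(locPrimeSubalgebra T P hP)
      ↥(locPrime (splitModel (locPrimeSubalgebra T P hP) f) (splitPrime (locPrimeSubalgebra T P hP) f) hPf)))) := hgfin
  haveI : Flat (Y := Spec (.of ↥(locPrime T P hP))) (Spec.map (CommRingCat.ofHom (algebraMap ↥(locPrimeSubalgebra T P hP)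
      ↥(locPrime (splitModel (locPrimeSubalgebra T P hP) f) (splitPrime (locPrimeSubalgebra T P hP) f) hPf)))) := hgflat
  haveI : FormallyUnramified (Y := Spec (.of ↥(locPrime T P hP))) (Spec.map (CommRingCat.ofHom (algebraMap
      ↥(locPrimeSubalgebra T P hP) ↥(locPrime (splitModel (locPrimeSubalgebra T P hP) f)
        (splitPrime (locPrimeSubalgebra T P hP) f) hPf)))) := hgunr
  haveI : LocallyOfFiniteType (Y := Spec (.of ↥(locPrime T P hP))) (Spec.map (CommRingCat.ofHom (algebraMap
      ↥(locPrimeSubalgebra T P hP) ↥(locPrime (splitModel (locPrimeSubalgebra T P hP) f)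
        (splitPrime (locPrimeSubalgebra T P hP) f) hPf)))) := by
    haveI := hgfin
    exact (inferInstance : LocallyOfFiniteType (Spec.map (CommRingCat.ofHom (algebraMap ↥(locPrimeSubalgebra T P hP)
      ↥(locPrime (splitModel (locPrimeSubalgebra T P hP) f) (splitPrime (locPrimeSubalgebra T P hP) f) hPf)))))
  -- ### the base change `σ = pullback.fst π g`, `π_f = pullback.snd π g`
  haveI : IsFinite (pullback.fst π (Spec.map (CommRingCat.ofHom (algebraMap ↥(locPrimeSubalgebra T P hP)
      ↥(locPrime (splitModel (locPrimeSubalgebra T P hP) f) (splitPrime (locPrimeSubalgebra T P hP) f) hPf))))) :=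
    MorphismProperty.pullback_fst _ _ inferInstance
  haveI : Flat (pullback.fst π (Spec.map (CommRingCat.ofHom (algebraMap ↥(locPrimeSubalgebra T P hP)
      ↥(locPrime (splitModel (locPrimeSubalgebra T P hP) f) (splitPrime (locPrimeSubalgebra T P hP) f) hPf))))) :=
    MorphismProperty.pullback_fst _ _ inferInstance
  haveI : FormallyUnramified (pullback.fst π (Spec.map (CommRingCat.ofHom (algebraMap ↥(locPrimeSubalgebra T P hP)
      ↥(locPrime (splitModel (locPrimeSubalgebra T P hP) f) (splitPrime (locPrimeSubalgebra T P hP) f) hPf))))) :=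
    MorphismProperty.pullback_fst _ _ inferInstance
  haveI : LocallyOfFiniteType (pullback.fst π (Spec.map (CommRingCat.ofHom (algebraMap ↥(locPrimeSubalgebra T P hP)
      ↥(locPrime (splitModel (locPrimeSubalgebra T P hP) f) (splitPrime (locPrimeSubalgebra T P hP) f) hPf))))) :=
    MorphismProperty.pullback_fst _ _ inferInstance
  have hπf : IsResolution (pullback.snd π (Spec.map (CommRingCat.ofHom (algebraMap ↥(locPrimeSubalgebra T P hP)
      ↥(locPrime (splitModel (locPrimeSubalgebra T P hP) f) (splitPrime (locPrimeSubalgebra T P hP) f) hPf))))) :=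
    isResolution_pullback_germ h161 (locPrimeSubalgebra T P hP) f hf hirr hsep hPf πD hπ
  haveI := hπf.isIntegral_source
  -- ### (U2w) counts upstairs: the splitting clause at the exceptional curves of `π`, transported down the lifts
  have hsplitπ :
      ∀ (η : X) (hη : η ∈ excCurvePoints πD), letI := (πD.residueFieldMap η).hom.toAlgebra
        letI := (((Spec (.of ↥(locPrimeSubalgebra T P hP))).residueFieldCongr (hyg.trans hη.1.symm)).inv ≫
          (Spec.map (CommRingCat.ofHom (algebraMap ↥(locPrimeSubalgebra T P hP)
            ↥(locPrime (splitModel (locPrimeSubalgebra T P hP) f) (splitPrime (locPrimeSubalgebra T P hP) f) hPf)))).residueFieldMap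
            (closedPoint ↥(locPrime (splitModel (locPrimeSubalgebra T P hP) f) (splitPrime (locPrimeSubalgebra T P hP) f) hPf))).hom.toAlgebra
        ∀ x : separableClosure ((Spec (.of ↥(locPrimeSubalgebra T P hP))).residueField (πD.base η)) (X.residueField η),
          ((minpoly ((Spec (.of ↥(locPrimeSubalgebra T P hP))).residueField (πD.base η)) x).map
            (algebraMap ((Spec (.of ↥(locPrimeSubalgebra T P hP))).residueField (πD.base η))
              ((Spec (.of ↥(locPrime (splitModel (locPrimeSubalgebra T P hP) f) (splitPrime (locPrimeSubalgebra T P hP) f) hPf))).residueField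
                (closedPoint ↥(locPrime (splitModel (locPrimeSubalgebra T P hP) f)
                  (splitPrime (locPrimeSubalgebra T P hP) f) hPf))))).Splits := by
    intro η hη x
    obtain ⟨η1, hη1, hρη1, -⟩ := exists_mem_excCurvePoints_apply_eq_and_bijective π ρ hdim hψ hπ hη
    subst hρη1
    exact splits_clause_of_comp (D := ↥(locPrimeSubalgebra T P hP)) πD ρ η1 (hyg.trans hη.1.symm)
      (hcl η1 (Or.inl hη1) (hyg.trans hη.1.symm)) x
  have hcount := upstairs_count_le (locPrimeSubalgebra T P hP) f hf hirr hsep hPf πD hfin hle hyg hsplitπ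
  -- ### the centre upstairs and (BC-ρ)
  have hNcfin := finite_preimage_sepNodes π (pullback.fst π (Spec.map (CommRingCat.ofHom (algebraMap
      ↥(locPrimeSubalgebra T P hP) ↥(locPrime (splitModel (locPrimeSubalgebra T P hP) f)
        (splitPrime (locPrimeSubalgebra T P hP) f) hPf))))) hfin
  have hNccl : ∀ z₁ ∈ (pullback.fst π (Spec.map (CommRingCat.ofHom (algebraMap ↥(locPrimeSubalgebra T P hP)
      ↥(locPrime (splitModel (locPrimeSubalgebra T P hP) f) (splitPrime (locPrimeSubalgebra T P hP) f) hPf))))).base ⁻¹'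
        sepNodes π, IsClosed ({z₁} : Set _) :=
    fun z₁ hz₁ => isClosed_singleton_of_preimage_sepNodes π _ hz₁
  have hρf := isBlowup_pullback_snd_preimage_sepNodes_of_formallyUnramified π ρ (pullback.fst π (Spec.map
      (CommRingCat.ofHom (algebraMap ↥(locPrimeSubalgebra T P hP) ↥(locPrime (splitModel (locPrimeSubalgebra T P hP) f)
        (splitPrime (locPrimeSubalgebra T P hP) f) hPf))))) hfin hρ
  -- ### hsplit upstairs: (S3) + (HTWO) + the field step
  have hnode := NodeBlowup.hnode π ρ hfin hdim hπ hρ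
  have hlift : ∀ η ∈ excCurvePoints π, ∃ η1 ∈ excCurvePoints (ρ ≫ π), ρ.base η1 = η ∧ Function.Bijective (ρ.stalkMap η1) :=
    fun η hη => exists_mem_excCurvePoints_apply_eq_and_bijective π ρ hdim hψ hπ hη
  have hsplitf := hsplit_upstairs_pullback π (pullback.snd π (Spec.map (CommRingCat.ofHom (algebraMap
      ↥(locPrimeSubalgebra T P hP) ↥(locPrime (splitModel (locPrimeSubalgebra T P hP) f)
        (splitPrime (locPrimeSubalgebra T P hP) f) hPf)))))
    (pullback.fst π _) (Spec.map (CommRingCat.ofHom (algebraMap ↥(locPrimeSubalgebra T P hP)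
      ↥(locPrime (splitModel (locPrimeSubalgebra T P hP) f) (splitPrime (locPrimeSubalgebra T P hP) f) hPf))))
    pullback.condition hg ρ h131d hdimf hratf hπf hfin hρ
    (htwo_discharge_of_inter π (pullback.fst π _) ρ (pullback.snd ρ (pullback.fst π _)) (pullback.fst ρ (pullback.fst π _))
      h131d hdim hrat hψ (IsPullback.of_hasPullback ρ _) hnode hlift (by
        intro y a b ha hb hab hay hby z₁ h h2
        -- the node `ρ y` lies over the closed point
        have hyc : (ρ ≫ π).base y = closedPoint _ := base_eq_closedPoint_of_specializes (ρ ≫ π) ha.1 hay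
        have hz₁ : (pullback.snd π (Spec.map (CommRingCat.ofHom (algebraMap ↥(locPrimeSubalgebra T P hP)
            ↥(locPrime (splitModel (locPrimeSubalgebra T P hP) f) (splitPrime (locPrimeSubalgebra T P hP) f) hPf))))).base z₁ =
            closedPoint _ :=
          snd_eq_closedPoint_of_fst π _ hg z₁ (by
            have hyc' : π.base (ρ.base y) = closedPoint _ := hyc
            exact (congrArg (fun t => π.base t) h).trans hyc')
        -- `halg`: `κ(y)` is finite over `κ(𝔪)` (a non-generic point of an exceptional curve), hence so is `κ(ρ y)`
        have halg : letI := (πD.residueFieldMap (ρ.base y)).hom.toAlgebra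
            Algebra.IsAlgebraic ((Spec (.of ↥(locPrimeSubalgebra T P hP))).residueField (πD.base (ρ.base y)))
              (X.residueField (ρ.base y)) := by
          letI algK : Algebra ((Spec (.of ↥(locPrimeSubalgebra T P hP))).residueField (πD.base (ρ.base y)))
              (X.residueField (ρ.base y)) := (πD.residueFieldMap (ρ.base y)).hom.toAlgebra
          letI algF : Algebra ((Spec (.of ↥(locPrimeSubalgebra T P hP))).residueField (πD.base (ρ.base y)))
              (X1.residueField y) := ((ρ ≫ πD).residueFieldMap y).hom.toAlgebra
          letI algKF : Algebra (X.residueField (ρ.base y)) (X1.residueField y) := (ρ.residueFieldMap y).hom.toAlgebra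
          haveI : IsScalarTower ((Spec (.of ↥(locPrimeSubalgebra T P hP))).residueField (πD.base (ρ.base y)))
              (X.residueField (ρ.base y)) (X1.residueField y) :=
            IsScalarTower.of_algebraMap_eq fun a => by
              change ((ρ ≫ πD).residueFieldMap y).hom a = (ρ.residueFieldMap y).hom ((πD.residueFieldMap (ρ.base y)).hom a)
              rw [Scheme.residueFieldMap_comp]
              rfl
          have hfinY : Module.Finite ((Spec (.of ↥(locPrimeSubalgebra T P hP))).residueField (πD.base (ρ.base y)))
              (X1.residueField y) := by
            by_cases hya : y = a
            · subst hya
              exact finite_residueField_of_specializes (ρ ≫ πD) hb hby hab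
            · exact finite_residueField_of_specializes (ρ ≫ πD) ha hay hya
          haveI := hfinY
          haveI : Algebra.IsAlgebraic ((Spec (.of ↥(locPrimeSubalgebra T P hP))).residueField (πD.base (ρ.base y)))
              (X1.residueField y) :=
            Algebra.IsAlgebraic.of_finite _ _
          exact Algebra.IsAlgebraic.tower_bot _ _ (X1.residueField y)
        exact hfibre_of_splitting πD ρ (pullback.fst π _) (pullback.snd π _) _ pullback.condition y z₁ h hz₁
          (hyg.trans hyc.symm) halg (hcl y (Or.inr ⟨a, ha, b, hb, hab, hay, hby⟩) (hyg.trans hyc.symm)) h2))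
  refine ⟨f, hf, hirr, hsep, hfact, hPf, hπf, hcount.2.2.1, hcount.2.2.2.1, hNcfin, hNccl, hρf, hsplitf, ?_⟩
  -- ### (BC-I) principality upstairs
  have hsq1 : pullback.fst ρ (pullback.fst π (Spec.map (CommRingCat.ofHom (algebraMap ↥(locPrimeSubalgebra T P hP)
      ↥(locPrime (splitModel (locPrimeSubalgebra T P hP) f) (splitPrime (locPrimeSubalgebra T P hP) f) hPf))))) ≫ (ρ ≫ π) =
      (pullback.snd ρ (pullback.fst π _) ≫ pullback.snd π _) ≫ Spec.map (CommRingCat.ofHom (algebraMap ↥(locPrimeSubalgebra T P hP)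
        ↥(locPrime (splitModel (locPrimeSubalgebra T P hP) f) (splitPrime (locPrimeSubalgebra T P hP) f) hPf))) := by
    rw [← Category.assoc, pullback.condition, Category.assoc, pullback.condition, Category.assoc]
    rfl
  have hCD : C ⊆ ((locPrimeSubalgebra T P hP : Subalgebra k K) : Set K) :=
    fun c hc => le_locPrimeSubalgebra T P hP (hCT hc)
  intro x₁ hx₁
  have hI := isPrincipal_map_toStalk_of_sq (algebraMap ↥(locPrimeSubalgebra T P hP)
      ↥(locPrime (splitModel (locPrimeSubalgebra T P hP) f) (splitPrime (locPrimeSubalgebra T P hP) f) hPf))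
    ψD (pullback.snd ρ (pullback.fst π _) ≫ pullback.snd π _) (pullback.fst ρ (pullback.fst π _)) hsq1
    (Ideal.span {d : ↥(locPrimeSubalgebra T P hP) | (d : K) ∈ C}) hprin x₁ hx₁
  rw [Ideal.map_span, ← preimage_image_coe_eq (locPrimeSubalgebra T P hP) f hPf C hCD] at hI
  exact hI

end Summit.ResolutionOfSingularities.ResolutionOfSingularities.Theorems.NoZeno.ExcCount

end
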